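import Literature.LinearAlgebra.TensorNetworks.TensorCrossInterpolation
import Literature.LinearAlgebra.Matrix.MaximalVolumePivot
import Literature.LinearAlgebra.Matrix.MaximalVolumeErrorBounds

/-!
# Error propagation of tensor cross interpolation along the train (Savostyanov's Theorem 2)

[Savostyanov2014, §4] analyses the accuracy of the tensor (TT) cross interpolation formula
`Ã = T₀ P₁⁻¹ T₁ ⋯ P_n⁻¹ T_n` (`Literature.LinearAlgebra.TensorNetworks.TCIPivots.tciForm`; pivot
matrices `P_ℓ = A(I_ℓ, J_{ℓ+1})`, site slices `T_ℓ^a = A(I_ℓ, a ⊕ J_{ℓ+2})`) built along the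
train with RIGHT-NESTED column sets `J_{ℓ+1} ⊆ 𝕊_ℓ × J_{ℓ+2}` and maximal-volume crosses.
THEOREM 2 there: if the tensor is entrywise within `E_C` of a tensor train with ranks `r_k ≤ r`
(the standing assumption of [Savostyanov2014, §3]) and every cross `(I^{≤k}, J^{>k})` is a
maximal-volume submatrix of the sub-unfolding `[A(i_{≤k}, i_{k+1} J^{>k+1})]`, then
`|A - Ã| ≤ (r^{d-1} - 1)/(r - 1) · (r+1)² E_C` in the Chebyshev norm.  Its proof is the ERROR
RECURSION `Δ_{k+1} = E_k + Σ_{s,t} Δ_k(·, J^{>k}_t) B^{[k]}_{t s} A(I^{≤k}_s, i_{k+1} J^{>k+1})`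
(`B^{[k]} = A_k⁻¹`), with `|B^{[k]} A(I^{≤k}, i_{k+1} J^{>k+1})| ≤ 1` by the dominance of a
maximal-volume submatrix [Savostyanov2014, §2] and `|E_k| ≤ (r_k+1)² E_C` by the matrix
maximal-volume principle [Savostyanov2014, §3 Lemma 1] (= [GoreinovTyrtyshnikov2001, Thm 2.2],
`Literature.LinearAlgebra.Matrix.abs_sub_crossInterp_le_of_volume_maximal`), and LEMMA 3
(right-nestedness makes the partial trains interpolate the subtensors `A(i_{≤k}, J^{>k})`).
[DolgovSavostyanov2020, §3.2] records this as the extension of the matrix maximal-volume error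
bounds to the tensor case.

DICTIONARY.  Legs `0, …, n` of `p : TCIPivots σ` are Savostyanov's `1, …, d`, `d = n + 1`; bond
`ℓ` (legs `< ℓ` | legs `≥ ℓ`) is his `k = ℓ`, `p.row ℓ = I^{≤ℓ}`, `p.col ℓ = J^{>ℓ}`,
`P_ℓ = A_ℓ`, `B^{[ℓ]} = P_ℓ⁻¹`; `coeffMat ℓ a = B^{[ℓ]} A(I^{≤ℓ}, a J^{>ℓ+1})`; the level-`k`
partial train `lvlForm s k` (free column index over `J_{k+2} = col (k+1)`) is his interpolation of
`A(i_{≤k+1}, J^{>k+1})`, so `lvlErr s k = Δ_{k+1}` and `bondErr ℓ = E_ℓ`; `lvlErr s 0 = 0`,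
`lvlErr s 1 = E_1` (his base case `d = 2`) and `lvlErr s n = Δ_d = A - Ã`.
This file formalises, over a commutative ring (identities), a normed field (bounds) and `ℝ`
(Theorem 2 itself):

* `unfoldingKernel`, `TCIPivots.coeffMat`, `lvlForm`, `lvlErr`, `bondErr`, `errBound`, `rowVec`,
  `subUnfolding` — the objects above; `bondErr_eq_sub_crossInterp` — `E_ℓ` IS the error of the
  matrix cross interpolation (`Literature.LinearAlgebra.Matrix.crossInterp`) of the bond-`ℓ`
  unfolding on `(I_ℓ, J_{ℓ+1})` [Savostyanov2014, §3]; `bondErr_pivotRow`, `bondErr_of_col_eq` —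
  it vanishes on the cross;
* `lvlForm_succ`, `lvlErr_succ` — THE ERROR RECURSION of the proof of Theorem 2
  (`Δ_{k+2} = E_{k+1} + Σ_t Δ_{k+1}(t) (C_{k+1}^{s(k+1)})_{t ·}`), an exact identity for ARBITRARY
  pivots (no nesting, no maximality); `lvlErr_zero`, `lvlErr_one`, `tciForm_eq_lvlForm`,
  `sub_tciEval_eq_lvlErr` (`A(s) - Ã(s) = Δ_d(s)`);
* `tciForm_apply_eq_lvlForm_of_colNested`, `sub_tciEval_eq_lvlErr_of_colNested` — LEMMA 3:
  under right-nestedness of `J_{k+2}, …, J_{n+1}` the full train at a configuration ending in a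
  column pivot `col (k+1) y` equals the level-`k` partial train, so `Δ_{k+1}` is the actual
  interpolation error on the subtensor `A(i_{≤k+1}, J^{>k+1})`;
* `coeffMat_mul_det` (Cramer form of the coefficients, via
  `Literature.LinearAlgebra.Matrix.inv_submatrix_mul_apply_mul_det`),
  `norm_coeffMat_le_of_det_exchange_le`, `norm_coeffMat_le_one_of_volume_maximal` — DOMINANCE:
  if exchanging a pivot column for a column of `A(I_ℓ, 𝕊_ℓ × J_{ℓ+2})` multiplies `‖det P_ℓ‖` by
  at most `c` (`c = 1`: maximal volume) then `‖B^{[ℓ]} A(I^{≤ℓ}, a J^{>ℓ+1})‖ ≤ c`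
  [Savostyanov2014, §2 and §4, proof of Thm. 2]; `sum_norm_coeffMat_le`;
* `norm_lvlErr_succ_le` — ONE AMPLIFICATION STEP `‖Δ_{k+2}‖ ≤ e + γ ‖Δ_{k+1}‖`;
  `norm_lvlErr_le_errBound`, `norm_sub_tciEval_le_errBound` — the accumulated bound with
  PER-BOND local errors `e_ℓ` and amplification factors `γ_ℓ` (`errBound`, the recursion
  `b_{k+1} = e_{k+1} + γ_{k+1} b_k`); `errBound_le_mul_geom_sum`,
  `norm_sub_tciEval_le_mul_geom_sum`, `norm_sub_tciEval_le_of_dominant`,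
  `norm_sub_tciEval_le_of_dominant'` — uniform `e_ℓ ≤ e₀`, `χ_ℓ ≤ r` and dominance give
  `‖A(s) - Ã(s)‖ ≤ e₀ (1 + r + ⋯ + r^{n-1}) = e₀ (r^n - 1)/(r - 1)`, Savostyanov's coefficient
  `(r^{d-1} - 1)/(r - 1)`, for ANY normed field and without nesting (the local errors `e_ℓ` then
  refer to the rows met by the configuration, `bondErr ℓ (s_0 … s_{ℓ-1})`);
* `subUnfolding_submatrix_eq_pivMat`, `submatrix_unfoldingKernel_update_eq`,
  `bondErr_eq_sub_crossInterp_subUnfolding` — where NESTING enters: with right-nesting witnesses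
  `c` (`col ℓ t = (c t).1 ⊕ col (ℓ+1) (c t).2`) the pivot matrix and the local errors live inside
  the sub-unfolding `[A(i_{<ℓ} ; 𝕊_ℓ × J_{ℓ+2})]` (rows: all length-`ℓ` multi-indices);
* `abs_sub_tciEval_le_of_volume_maximal`, `abs_sub_tciEval_le_of_volume_maximal'` — THEOREM 2
  (Chebyshev version) for real tensors with finitely many leg values: right-nested columns,
  `P_ℓ` nonsingular and of maximal volume in the sub-unfolding of bond `ℓ`, each sub-unfolding
  within `δ` of a matrix of rank `≤ χ_ℓ`, `χ_ℓ ≤ r` (`1 ≤ ℓ ≤ n`) ⟹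
  `|A(s) - Ã(s)| ≤ (r+1)² δ (1 + r + ⋯ + r^{n-1}) = (r^{d-1} - 1)/(r - 1) · (r+1)² δ`.

The recursion and the `e_ℓ / γ_ℓ` bounds are stated for arbitrary pivots on purpose: they are the
form that applies to crosses that are nested on one side only (as after a half-sweep of a
two-site algorithm, [NunezFernandezEtAl2025, §4.2]) and to pivots found by partial (rook)
pivoting, whose amplification factor is `2^{χ_ℓ} - 1`
(`Literature.LinearAlgebra.Matrix.IsRowPivoted.norm_inv_submatrix_mul_apply_le_two_pow`) rather
than `χ_ℓ`, or `χ_ℓ c` for `c`-dominant pivot matrices.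

NOT formalised: the Frobenius-norm half of Theorem 2 (`(r+1)² E_F`), Theorem 1 (balanced
dimension tree, exponent `⌈log₂ d⌉`), Lemma 2 and Theorem 3 (relative accuracy in terms of the
Chebyshev condition numbers of the `A_k`), the QTT discussion of §5, sharpness of the
coefficient, and the existence or computation of maximal-volume / nested pivots (maxvol and the
DMRG / ALS / greedy cross algorithms of [DolgovSavostyanov2020, §3.3]) — the hypotheses record the
outcome of such a search, not an algorithm.

References: D. V. Savostyanov, *Quasioptimality of maximum-volume cross interpolation of
tensors*, Linear Algebra Appl. 458 (2014) 217–244 (arXiv:1305.1818; section, theorem and lemma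
numbering as in the arXiv version): §2, §3 Lemma 1, §4 Theorem 2, Lemma 3 and the proof of
Theorem 2; S. Dolgov, D. Savostyanov, *Parallel cross interpolation for high-precision
calculation of high-dimensional integrals*, Comput. Phys. Commun. 246 (2020) 106869
(arXiv:1903.11554), §3.1–3.2; Y. Núñez Fernández et al., *Learning tensor networks with tensor
cross interpolation: new algorithms and libraries*, SciPost Phys. 18 (2025) 104
(arXiv:2407.02454), §3.1, §4.1–4.2, App. A.3.
AI-produced formalisation (H21 engines group, seat eng-quad-2, 2026-08-21); no facts, no axioms
beyond Mathlib's, no `sorry`.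
-/

open Matrix Finset

namespace Literature.LinearAlgebra.TensorNetworks

section Config

variable {σ : Type*}

/-- [folklore] -/
private theorem pfx_succ' (s : ℕ → σ) (k : ℕ) : pfx s (k + 1) = pfx s k ++ [s k] := rfl

/-- [folklore] -/
private theorem sfx_succ_left (s : ℕ → σ) (k m : ℕ) :
    sfx s k (m + 1) = s k :: sfx s (k + 1) m := rfl

/-- [folklore] -/
private theorem sfx_succ_right (s : ℕ → σ) (k m : ℕ) :
    sfx s k (m + 1) = sfx s k m ++ [s (k + m)] := by
  induction m generalizing k with
  | zero => simp [sfx_succ_left]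
  | succ m ih =>
      rw [sfx_succ_left, ih (k + 1), sfx_succ_left, List.cons_append,
        show k + 1 + m = k + (m + 1) by omega]

/-- [folklore] -/
private theorem pfx_add' (s : ℕ → σ) (k m : ℕ) : pfx s (k + m) = pfx s k ++ sfx s k m := by
  induction m with
  | zero => simp
  | succ m ih => rw [← Nat.add_assoc, pfx_succ', ih, sfx_succ_right, List.append_assoc]

variable {K : Type*}

/-- The UNFOLDING KERNEL of a tensor `F : List σ → K` given on configurations: the matrix
indexed by all multi-indices with `(i, j) ↦ F (i ⊕ j)`.  Its restriction to row multi-indices of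
length `ℓ` and column multi-indices of length `n + 1 - ℓ` is the `ℓ`-th unfolding `A^{(ℓ)}` of an
`(n+1)`-leg tensor; the pivot matrix `P_ℓ = F(I_ℓ, J_{ℓ+1})` and the blocks `F(I_ℓ, 𝕊 × J_{ℓ+2})`
used below are submatrices of it (`TCIPivots.pivMat_eq_submatrix_unfoldingKernel`).
[cite: Savostyanov2014, §2][cite: DolgovSavostyanov2020, §3.1] -/
def unfoldingKernel (F : List σ → K) : Matrix (List σ) (List σ) K :=
  Matrix.of fun i j => F (i ++ j)

/-- Entries of the unfolding kernel: `(i, j) ↦ F (i ⊕ j)`.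
[cite: Savostyanov2014, §2][cite: DolgovSavostyanov2020, §3.1] -/
@[simp] theorem unfoldingKernel_apply (F : List σ → K) (i j : List σ) :
    unfoldingKernel F i j = F (i ++ j) := rfl

end Config

section ErrBound

/-- The ACCUMULATED ERROR BOUND `B_k` defined by `B_0 = 0`, `B_{k+1} = e_{k+1} + γ_{k+1} B_k`
from per-bond local error bounds `e_ℓ` and amplification factors `γ_ℓ`; explicitly
`B_k = Σ_{1 ≤ j ≤ k} e_j Π_{j < i ≤ k} γ_i`.  [cite: Savostyanov2014, §4, proof of Thm. 2] -/
def errBound (e γ : ℕ → ℝ) : ℕ → ℝ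
  | 0 => 0
  | k + 1 => e (k + 1) + γ (k + 1) * errBound e γ k

/-- `B_0 = 0`.  [cite: Savostyanov2014, §4, proof of Thm. 2] -/
@[simp] theorem errBound_zero (e γ : ℕ → ℝ) : errBound e γ 0 = 0 := rfl

/-- `B_{k+1} = e_{k+1} + γ_{k+1} B_k`.  [cite: Savostyanov2014, §4, proof of Thm. 2] -/
theorem errBound_succ (e γ : ℕ → ℝ) (k : ℕ) :
    errBound e γ (k + 1) = e (k + 1) + γ (k + 1) * errBound e γ k := rfl

/-- `B_k ≥ 0` for nonnegative data.  [cite: Savostyanov2014, §4, proof of Thm. 2] -/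
theorem errBound_nonneg {e γ : ℕ → ℝ} (he : ∀ ℓ, 0 ≤ e ℓ) (hγ : ∀ ℓ, 0 ≤ γ ℓ) :
    ∀ k, 0 ≤ errBound e γ k
  | 0 => le_rfl
  | k + 1 => add_nonneg (he _) (mul_nonneg (hγ _) (errBound_nonneg he hγ k))

/-- Uniform data: if `e_ℓ ≤ e₀` and `γ_ℓ ≤ g` for `1 ≤ ℓ ≤ k` then `B_k ≤ e₀ Σ_{j<k} g^j`
(`= e₀ (g^k - 1)/(g - 1)` for `g ≠ 1`).  [cite: Savostyanov2014, §4 Thm. 2] -/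
theorem errBound_le_mul_geom_sum {e γ : ℕ → ℝ} (he : ∀ ℓ, 0 ≤ e ℓ) (hγ : ∀ ℓ, 0 ≤ γ ℓ)
    {e₀ g : ℝ} :
    ∀ k, (∀ ℓ, 1 ≤ ℓ → ℓ ≤ k → e ℓ ≤ e₀) → (∀ ℓ, 1 ≤ ℓ → ℓ ≤ k → γ ℓ ≤ g) →
      errBound e γ k ≤ e₀ * ∑ j ∈ Finset.range k, g ^ j
  | 0, _, _ => by simp
  | k + 1, hE, hG => by
      have ih := errBound_le_mul_geom_sum he hγ k (fun ℓ h₁ h₂ => hE ℓ h₁ (by omega))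
        (fun ℓ h₁ h₂ => hG ℓ h₁ (by omega))
      have hB := errBound_nonneg he hγ k
      have hg : 0 ≤ g := (hγ (k + 1)).trans (hG (k + 1) (by omega) le_rfl)
      have he₀ : 0 ≤ e₀ := (he (k + 1)).trans (hE (k + 1) (by omega) le_rfl)
      have hsum : ∑ j ∈ Finset.range (k + 1), g ^ j = g * ∑ j ∈ Finset.range k, g ^ j + 1 := by
        rw [Finset.sum_range_succ', Finset.mul_sum, pow_zero]
        simp_rw [pow_succ']
      rw [errBound_succ, hsum]
      calc e (k + 1) + γ (k + 1) * errBound e γ k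
          ≤ e₀ + g * (e₀ * ∑ j ∈ Finset.range k, g ^ j) :=
            add_le_add (hE (k + 1) (by omega) le_rfl)
              ((mul_le_mul_of_nonneg_right (hG (k + 1) (by omega) le_rfl) hB).trans
                (mul_le_mul_of_nonneg_left ih hg))
        _ = e₀ * (g * ∑ j ∈ Finset.range k, g ^ j + 1) := by ring

end ErrBound

namespace TCIPivots

variable {σ : Type*} (p : TCIPivots σ)

section CommRing

variable {K : Type*} [CommRing K] (F : List σ → K)

/-- The COLUMN COEFFICIENT MATRIX of bond `ℓ` at leg value `a`: `C_ℓ^a = P_ℓ⁻¹ T_ℓ^a`, a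
`χ_ℓ × χ_{ℓ+1}` matrix; its column `y'` holds the coefficients expressing the column
`(a) ⊕ col (ℓ+1) y' ∈ 𝕊 × J_{ℓ+2}` of the pivot-row block `F(I_ℓ, ·)` in terms of the pivot
columns `J_{ℓ+1}` (Savostyanov's `B^{[k]} A(I^{≤k}, i_{k+1} J^{>k+1})`, `B^{[k]} = A_k⁻¹`).
[cite: Savostyanov2014, §4, proof of Thm. 2][cite: NunezFernandezEtAl2025, App. A.3] -/
noncomputable def coeffMat (ℓ : ℕ) (a : σ) : Matrix (Fin (p.χ ℓ)) (Fin (p.χ (ℓ + 1))) K :=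
  (p.pivMat F ℓ)⁻¹ * p.siteMat F ℓ a

/-- The LEVEL-`k` PARTIAL TRAIN `G_k(s) = T₀^{s 0} P₁⁻¹ T₁^{s 1} ⋯ P_k⁻¹ T_k^{s k}`, a
`χ_0 × χ_{k+1}` (row) matrix: the train truncated after leg `k`, its free column index running over
the column pivots `J_{k+2}` of bond `k+1` (Savostyanov's interpolation of the subtensor
`A(i_{≤k}, J^{>k})`, Lemma 3).  `G_n(s)` is the full TCI form (`tciForm_eq_lvlForm`).
[cite: Savostyanov2014, §4 Lemma 3] -/
noncomputable def lvlForm (s : ℕ → σ) (k : ℕ) : Matrix (Fin (p.χ 0)) (Fin (p.χ (k + 1))) K :=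
  p.leftProd F s k * p.siteMat F k (s k)

/-- The LEVEL-`k` ERROR `Δ_k(s; y) = F((s 0, …, s k) ⊕ col (k+1) y) - G_k(s)_y` on the subtensor
`A(i_{≤k}, J^{>k})` (Savostyanov's `Δ_k`); `Δ_n` is the interpolation error `F - F̃` itself
(`sub_tciEval_eq_lvlErr`).  [cite: Savostyanov2014, §4, proof of Thm. 2] -/
noncomputable def lvlErr (s : ℕ → σ) (k : ℕ) (y : Fin (p.χ (k + 1))) : K :=
  F (pfx s (k + 1) ++ p.col (k + 1) y) - p.lvlForm F s k p.rowZero y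

/-- The LOCAL (ONE-BOND) CROSS-INTERPOLATION ERROR at bond `ℓ`: for a row multi-index `i`
(legs `< ℓ`) and the column `(a) ⊕ col (ℓ+1) y'`,
`E_ℓ(i; a, y') = F(i ⊕ a ⊕ col (ℓ+1) y') - Σ_t F(i ⊕ col ℓ t) · (C_ℓ^a)_{t y'}`, i.e. the error at
`(i, (a) ⊕ col (ℓ+1) y')` of the matrix cross interpolation of the bond-`ℓ` unfolding on the
pivots `(I_ℓ, J_{ℓ+1})` (`bondErr_eq_sub_crossInterp`; Savostyanov's `E_k`).
[cite: Savostyanov2014, §4, proof of Thm. 2][cite: Savostyanov2014, §3] -/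
noncomputable def bondErr (ℓ : ℕ) (i : List σ) (a : σ) (y' : Fin (p.χ (ℓ + 1))) : K :=
  F (i ++ a :: p.col (ℓ + 1) y') - ∑ t, F (i ++ p.col ℓ t) * p.coeffMat F ℓ a t y'

omit [CommRing K] in
/-- The pivot matrix is the submatrix `(I_ℓ, J_{ℓ+1})` of the unfolding kernel.
[cite: Savostyanov2014, §2][cite: DolgovSavostyanov2020, §3.1] -/
theorem pivMat_eq_submatrix_unfoldingKernel (ℓ : ℕ) :
    p.pivMat F ℓ = (unfoldingKernel F).submatrix (p.row ℓ) (p.col ℓ) := rfl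

/-- Entries of the coefficient matrix:
`(C_ℓ^a)_{t y'} = Σ_u (P_ℓ⁻¹)_{t u} F(row ℓ u ⊕ a ⊕ col (ℓ+1) y')`.
[cite: Savostyanov2014, §4, proof of Thm. 2] -/
theorem coeffMat_apply (ℓ : ℕ) (a : σ) (t : Fin (p.χ ℓ)) (y' : Fin (p.χ (ℓ + 1))) :
    p.coeffMat F ℓ a t y' =
      ∑ u, (p.pivMat F ℓ)⁻¹ t u * F (p.row ℓ u ++ a :: p.col (ℓ + 1) y') := by
  simp [coeffMat, Matrix.mul_apply]

/-- `P_ℓ C_ℓ^a = T_ℓ^a`: the pivot rows of the block `F(I_ℓ, 𝕊 × J_{ℓ+2})` are reproduced by the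
coefficients.  [cite: Savostyanov2014, §2][cite: NunezFernandezEtAl2025, §3.1 property (ii)] -/
theorem pivMat_mul_coeffMat {ℓ : ℕ} (hP : IsUnit (p.pivMat F ℓ).det) (a : σ) :
    p.pivMat F ℓ * p.coeffMat F ℓ a = p.siteMat F ℓ a := by
  rw [coeffMat, ← Matrix.mul_assoc, Matrix.mul_nonsing_inv _ hP, Matrix.one_mul]

/-- The local error IS a matrix cross-interpolation error: `E_ℓ(i; a, y')` is the entry
`(i, (a) ⊕ col (ℓ+1) y')` of `U - crossInterp U I_ℓ J_{ℓ+1}` for the unfolding kernel `U`.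
[cite: Savostyanov2014, §3][cite: NunezFernandezEtAl2025, §3.1] -/
theorem bondErr_eq_sub_crossInterp (ℓ : ℕ) (i : List σ) (a : σ) (y' : Fin (p.χ (ℓ + 1))) :
    p.bondErr F ℓ i a y' =
      (unfoldingKernel F -
        Literature.LinearAlgebra.Matrix.crossInterp (unfoldingKernel F) (p.row ℓ) (p.col ℓ))
        i (a :: p.col (ℓ + 1) y') := by
  rw [Literature.LinearAlgebra.Matrix.crossInterp, ← p.pivMat_eq_submatrix_unfoldingKernel F ℓ]
  simp only [bondErr, coeffMat, Matrix.sub_apply, Matrix.mul_apply, Matrix.submatrix_apply, id_eq,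
    unfoldingKernel_apply, siteMat_apply]
  congr 1
  simp only [Finset.mul_sum, Finset.sum_mul, mul_assoc]
  exact Finset.sum_comm

/-- The local error vanishes on the pivot rows: `E_ℓ(row ℓ x; a, y') = 0`.
[cite: Savostyanov2014, §2][cite: NunezFernandezEtAl2025, §3.1 property (ii)] -/
theorem bondErr_pivotRow {ℓ : ℕ} (hP : IsUnit (p.pivMat F ℓ).det) (x : Fin (p.χ ℓ)) (a : σ)
    (y' : Fin (p.χ (ℓ + 1))) : p.bondErr F ℓ (p.row ℓ x) a y' = 0 := by
  have h := congr_fun (congr_fun (p.pivMat_mul_coeffMat F hP a) x) y'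
  rw [Matrix.mul_apply] at h
  simp only [pivMat_apply, siteMat_apply] at h
  rw [bondErr, h, sub_self]

/-- The local error vanishes on the pivot columns: if `(a) ⊕ col (ℓ+1) y'` is itself a column
pivot `col ℓ t₀` of bond `ℓ` (as under column nesting `J_{ℓ+1} ⊆ 𝕊 × J_{ℓ+2}`), then
`E_ℓ(i; a, y') = 0` for every row `i`.
[cite: Savostyanov2014, §2][cite: NunezFernandezEtAl2025, App. A.3] -/
theorem bondErr_of_col_eq {ℓ : ℕ} (hP : IsUnit (p.pivMat F ℓ).det) {a : σ}
    {y' : Fin (p.χ (ℓ + 1))} {t₀ : Fin (p.χ ℓ)} (h : p.col ℓ t₀ = a :: p.col (ℓ + 1) y')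
    (i : List σ) : p.bondErr F ℓ i a y' = 0 := by
  unfold bondErr coeffMat
  simp_rw [p.inv_pivMat_mul_siteMat_apply F h hP]
  simp [h]

/-! ### The partial trains and the error recursion -/

/-- `G_0(s)_y = F((s 0) ⊕ col 1 y)`: the level-`0` partial train is a slice of `F` itself.
[cite: Savostyanov2014, §4, proof of Thm. 2] -/
theorem lvlForm_zero (s : ℕ → σ) (x₀ : Fin (p.χ 0)) (y : Fin (p.χ 1)) :
    p.lvlForm F s 0 x₀ y = F (s 0 :: p.col 1 y) := by
  have h0 : p.row 0 x₀ = [] := List.eq_nil_of_length_eq_zero (p.length_row 0 x₀)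
  simp [lvlForm, leftProd, h0]

/-- `Δ_0 = 0`: there is no error at level `0`.  [cite: Savostyanov2014, §4, proof of Thm. 2] -/
theorem lvlErr_zero (s : ℕ → σ) (y : Fin (p.χ 1)) : p.lvlErr F s 0 y = 0 := by
  simp [lvlErr, lvlForm_zero, pfx_succ']

/-- One step of the partial train: `G_{k+1}(s) = G_k(s) · C_{k+1}^{s (k+1)}`
(`= G_k(s) P_{k+1}⁻¹ T_{k+1}^{s (k+1)}`).  [cite: Savostyanov2014, §4, proof of Thm. 2] -/
theorem lvlForm_succ (s : ℕ → σ) (k : ℕ) :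
    p.lvlForm F s (k + 1) = p.lvlForm F s k * p.coeffMat F (k + 1) (s (k + 1)) := by
  simp only [lvlForm, coeffMat, leftProd_succ, Matrix.mul_assoc]

/-- THE ERROR RECURSION along the train:
`Δ_{k+1}(s; y') = E_{k+1}((s 0,…,s k); s (k+1), y') + Σ_t Δ_k(s; t) · (C_{k+1}^{s (k+1)})_{t y'}` —
the level-`(k+1)` error is the local cross-interpolation error of bond `k+1` plus the level-`k`
errors propagated through the coefficient matrix of bond `k+1`.
[cite: Savostyanov2014, §4, proof of Thm. 2] -/
theorem lvlErr_succ (s : ℕ → σ) (k : ℕ) (y' : Fin (p.χ (k + 1 + 1))) :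
    p.lvlErr F s (k + 1) y' =
      p.bondErr F (k + 1) (pfx s (k + 1)) (s (k + 1)) y' +
        ∑ t, p.lvlErr F s k t * p.coeffMat F (k + 1) (s (k + 1)) t y' := by
  have hcfg : pfx s (k + 1 + 1) ++ p.col (k + 1 + 1) y' =
      pfx s (k + 1) ++ s (k + 1) :: p.col (k + 1 + 1) y' := by
    rw [pfx_succ' s (k + 1), List.append_assoc, List.singleton_append]
  rw [lvlErr, hcfg, lvlForm_succ, Matrix.mul_apply]
  simp only [lvlErr, bondErr, sub_mul, Finset.sum_sub_distrib]
  ring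

/-- At the first inner bond there is nothing to propagate: `Δ_1(s; y') = E_1((s 0); s 1, y')`,
the plain matrix cross-interpolation error of the bond-`1` unfolding on `(I_1, J_2)`.
[cite: Savostyanov2014, §4, proof of Thm. 2] -/
theorem lvlErr_one (s : ℕ → σ) (y' : Fin (p.χ 2)) :
    p.lvlErr F s 1 y' = p.bondErr F 1 [s 0] (s 1) y' := by
  rw [p.lvlErr_succ F s 0 y']
  simp [lvlErr_zero, pfx_succ']

/-- The full TCI form is the level-`n` partial train: `F̃(s) = G_n(s)`.
[cite: Savostyanov2014, §4 Lemma 3][cite: NunezFernandezEtAl2025, §4.1] -/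
theorem tciForm_eq_lvlForm (s : ℕ → σ) : p.tciForm F s = p.lvlForm F s p.n := by
  rw [p.tciForm_eq_leftProd_mul_siteMat_mul_rightProd F s p.n le_rfl, rightProd_last,
    Matrix.mul_one, lvlForm]

/-- The interpolation error is the level-`n` error: `F(s) - F̃(s) = Δ_n(s; ())`.
[cite: Savostyanov2014, §4, proof of Thm. 2] -/
theorem sub_tciEval_eq_lvlErr (s : ℕ → σ) :
    F (pfx s (p.n + 1)) - p.tciEval F s = p.lvlErr F s p.n p.colLast := by
  have hcol : p.col (p.n + 1) p.colLast = [] :=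
    List.eq_nil_of_length_eq_zero (by simp [p.length_col])
  rw [lvlErr, hcol, List.append_nil, p.tciEval_eq_tciForm F s p.rowZero p.colLast,
    tciForm_eq_lvlForm]

/-- SAVOSTYANOV'S LEMMA 3 (right-nested sets): if the column pivots are nested from bond `k+1`
on, `J_{k+2} > J_{k+3} > ⋯ > J_{n+2}`, and the pivot matrices are nonsingular, then on the
subtensor `A(i_{≤k}, J_{k+2})` — configurations whose suffix `(s (k+1), …, s n)` is a column pivot
`col (k+1) y` — the TCI form equals the level-`k` partial train: `F̃(s) = G_k(s)_y` (the right
telescope `P_{k+1}⁻¹ T_{k+1} ⋯ P_n⁻¹ T_n` collapses to `e_y`).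
[cite: Savostyanov2014, §4 Lemma 3][cite: NunezFernandezEtAl2025, App. A.3] -/
theorem tciForm_apply_eq_lvlForm_of_colNested (s : ℕ → σ)
    (hP : ∀ ℓ, 1 ≤ ℓ → ℓ ≤ p.n → IsUnit (p.pivMat F ℓ).det) {k : ℕ} (hk : k ≤ p.n)
    (hJ : ∀ ℓ, k + 1 ≤ ℓ → ℓ ≤ p.n → p.ColNested ℓ)
    {y : Fin (p.χ (k + 1))} (hy : p.col (k + 1) y = sfx s (k + 1) (p.n - k))
    (x₀ : Fin (p.χ 0)) (y₀ : Fin (p.χ (p.n + 1))) :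
    p.tciForm F s x₀ y₀ = p.lvlForm F s k x₀ y := by
  rw [p.tciForm_eq_leftProd_mul_siteMat_mul_rightProd F s k hk, Matrix.mul_apply]
  have hr := p.rightProd_apply_of_colNested F s hP (p.n - k) (k + 1) (by omega) (Nat.succ_pos k)
    hJ y₀ y hy
  simp only [hr, mul_ite, mul_one, mul_zero, Finset.sum_ite_eq', Finset.mem_univ, if_true,
    lvlForm]

/-- Lemma 3 in error form: under column nesting from bond `k+1` on, the interpolation error
`F(s) - F̃(s)` at a configuration whose suffix from leg `k+1` is the column pivot `col (k+1) y`
IS the level-`k` error `Δ_k(s; y)`.  [cite: Savostyanov2014, §4 Lemma 3 and proof of Thm. 2] -/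
theorem sub_tciEval_eq_lvlErr_of_colNested (s : ℕ → σ)
    (hP : ∀ ℓ, 1 ≤ ℓ → ℓ ≤ p.n → IsUnit (p.pivMat F ℓ).det) {k : ℕ} (hk : k ≤ p.n)
    (hJ : ∀ ℓ, k + 1 ≤ ℓ → ℓ ≤ p.n → p.ColNested ℓ)
    {y : Fin (p.χ (k + 1))} (hy : p.col (k + 1) y = sfx s (k + 1) (p.n - k)) :
    F (pfx s (p.n + 1)) - p.tciEval F s = p.lvlErr F s k y := by
  have hcfg : pfx s (p.n + 1) = pfx s (k + 1) ++ p.col (k + 1) y := by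
    rw [hy, ← pfx_add', show k + 1 + (p.n - k) = p.n + 1 by omega]
  rw [lvlErr, ← hcfg, p.tciEval_eq_tciForm F s p.rowZero p.colLast,
    p.tciForm_apply_eq_lvlForm_of_colNested F s hP hk hJ hy]

/-! ### Cramer form of the coefficients -/

/-- CRAMER FORM OF THE COEFFICIENTS: `(C_ℓ^a)_{t y'} · det P_ℓ` is the determinant of the pivot
matrix with its `t`-th column replaced by the column `(a) ⊕ col (ℓ+1) y'` of the pivot-row block
`F(I_ℓ, ·)`.  [cite: Savostyanov2014, §2][cite: HornJohnson2013, §0.8.3] -/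
theorem coeffMat_mul_det {ℓ : ℕ} (hP : IsUnit (p.pivMat F ℓ).det) (a : σ) (t : Fin (p.χ ℓ))
    (y' : Fin (p.χ (ℓ + 1))) :
    p.coeffMat F ℓ a t y' * (p.pivMat F ℓ).det =
      ((unfoldingKernel F).submatrix (p.row ℓ)
        (Function.update (p.col ℓ) t (a :: p.col (ℓ + 1) y'))).det := by
  have hR : ((unfoldingKernel F).submatrix (p.row ℓ) id).submatrix id (p.col ℓ) = p.pivMat F ℓ :=
    rfl
  have hP' : IsUnit (((unfoldingKernel F).submatrix (p.row ℓ) id).submatrix id (p.col ℓ)).det := by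
    rw [hR]; exact hP
  have h := Literature.LinearAlgebra.Matrix.inv_submatrix_mul_apply_mul_det
    ((unfoldingKernel F).submatrix (p.row ℓ) id) (p.col ℓ) hP' t (a :: p.col (ℓ + 1) y')
  rw [hR] at h
  have hcoef : ((p.pivMat F ℓ)⁻¹ * (unfoldingKernel F).submatrix (p.row ℓ) id) t
      (a :: p.col (ℓ + 1) y') = p.coeffMat F ℓ a t y' := by
    simp only [coeffMat, Matrix.mul_apply, Matrix.submatrix_apply, id_eq, unfoldingKernel_apply,
      siteMat_apply]
  rw [hcoef] at h
  rw [h]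
  rfl

/-! ### The sub-unfoldings `A(i_{<ℓ} ; 𝕊_ℓ × J_{ℓ+2})` and column nesting -/

/-- The pivot rows `I_ℓ` of bond `ℓ` as length-`ℓ` vectors (row indices of the sub-unfolding).
[cite: Savostyanov2014, §4 Thm. 2] -/
def rowVec (ℓ : ℕ) (t : Fin (p.χ ℓ)) : List.Vector σ ℓ := ⟨p.row ℓ t, p.length_row ℓ t⟩

/-- The SUB-UNFOLDING of bond `ℓ`: rows = all multi-indices of the legs `< ℓ` (length-`ℓ`
vectors), columns = `𝕊_ℓ × J_{ℓ+2}` (a leg-`ℓ` value prepended to a column pivot of bond `ℓ+1`),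
entries `(i, (a, y')) ↦ F(i ⊕ a ⊕ col (ℓ+1) y')` — Savostyanov's matrix
`[A(i_{≤k}, i_{k+1} J^{>k+1})]` (`k = ℓ` in the 1-based leg numbering), in which Theorem 2
requires the pivots `(I_ℓ, J_{ℓ+1})` to have maximal volume.
[cite: Savostyanov2014, §4 Thm. 2] -/
def subUnfolding (ℓ : ℕ) : Matrix (List.Vector σ ℓ) (σ × Fin (p.χ (ℓ + 1))) K :=
  Matrix.of fun i j => F (i.1 ++ j.1 :: p.col (ℓ + 1) j.2)

omit [CommRing K] in
/-- Entries of the sub-unfolding. [cite: Savostyanov2014, §4 Thm. 2] -/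
@[simp] theorem subUnfolding_apply (ℓ : ℕ) (i : List.Vector σ ℓ) (j : σ × Fin (p.χ (ℓ + 1))) :
    p.subUnfolding F ℓ i j = F (i.1 ++ j.1 :: p.col (ℓ + 1) j.2) := rfl

omit [CommRing K] in
/-- Under COLUMN NESTING `J_{ℓ+1} ⊆ 𝕊_ℓ × J_{ℓ+2}` with explicit witnesses
`col ℓ t = (c t).1 ⊕ col (ℓ+1) (c t).2`, the pivot matrix `P_ℓ` is the submatrix `(I_ℓ, c)` of
the sub-unfolding of bond `ℓ` — this is where nesting enters Theorem 2: it makes `P_ℓ` a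
submatrix of the block in which it must have maximal volume.
[cite: Savostyanov2014, §4 Thm. 2 and eq. before it (right-nestedness)] -/
theorem subUnfolding_submatrix_eq_pivMat {ℓ : ℕ} {c : Fin (p.χ ℓ) → σ × Fin (p.χ (ℓ + 1))}
    (hc : ∀ t, p.col ℓ t = (c t).1 :: p.col (ℓ + 1) (c t).2) :
    (p.subUnfolding F ℓ).submatrix (p.rowVec ℓ) c = p.pivMat F ℓ := by
  ext t u
  simp [rowVec, hc u]

omit [CommRing K] in
/-- With nesting witnesses `c`, exchanging the `t`-th pivot column of `P_ℓ` for the column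
`(a) ⊕ col (ℓ+1) y'` inside the unfolding kernel is the same matrix as exchanging the `t`-th
column index `c t` for `(a, y')` inside the sub-unfolding.
[cite: Savostyanov2014, §2 and §4 Thm. 2] -/
theorem submatrix_unfoldingKernel_update_eq {ℓ : ℕ} {c : Fin (p.χ ℓ) → σ × Fin (p.χ (ℓ + 1))}
    (hc : ∀ t, p.col ℓ t = (c t).1 :: p.col (ℓ + 1) (c t).2) (t : Fin (p.χ ℓ)) (a : σ)
    (y' : Fin (p.χ (ℓ + 1))) :
    (unfoldingKernel F).submatrix (p.row ℓ) (Function.update (p.col ℓ) t (a :: p.col (ℓ + 1) y'))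
      = (p.subUnfolding F ℓ).submatrix (p.rowVec ℓ) (Function.update c t (a, y')) := by
  ext u v
  simp only [Matrix.submatrix_apply, unfoldingKernel_apply, subUnfolding_apply, rowVec]
  rw [Function.update_apply, Function.update_apply]
  split_ifs with h
  · rfl
  · rw [hc v]

/-- With nesting witnesses `c`, the local error `E_ℓ(i; a, y')` at a genuine row multi-index `i`
(length `ℓ`) is the entry `(i, (a, y'))` of the cross-interpolation error of the SUB-UNFOLDING of
bond `ℓ` on the pivots `(I_ℓ, c)` — the matrix to which the matrix-level maximal-volume error
bound applies.  [cite: Savostyanov2014, §3 Lemma 1 and §4, proof of Thm. 2] -/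
theorem bondErr_eq_sub_crossInterp_subUnfolding {ℓ : ℕ}
    {c : Fin (p.χ ℓ) → σ × Fin (p.χ (ℓ + 1))}
    (hc : ∀ t, p.col ℓ t = (c t).1 :: p.col (ℓ + 1) (c t).2) (i : List.Vector σ ℓ) (a : σ)
    (y' : Fin (p.χ (ℓ + 1))) :
    p.bondErr F ℓ i.1 a y' =
      (p.subUnfolding F ℓ -
        Literature.LinearAlgebra.Matrix.crossInterp (p.subUnfolding F ℓ) (p.rowVec ℓ) c)
        i (a, y') := by
  rw [Literature.LinearAlgebra.Matrix.crossInterp, p.subUnfolding_submatrix_eq_pivMat F hc]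
  have hc' : ∀ t, (c t).1 :: p.col (ℓ + 1) (c t).2 = p.col ℓ t := fun t => (hc t).symm
  simp only [bondErr, coeffMat, Matrix.sub_apply, Matrix.mul_apply, Matrix.submatrix_apply, id_eq,
    subUnfolding_apply, rowVec, siteMat_apply, hc']
  congr 1
  simp only [Finset.mul_sum, Finset.sum_mul, mul_assoc]
  exact Finset.sum_comm

end CommRing

/-! ### Norm bounds: per-bond amplification and the accumulated error -/

section Normed

variable {𝕜 : Type*} [NormedField 𝕜] (F : List σ → 𝕜)

/-- DOMINANCE BOUNDS THE COEFFICIENTS: if `P_ℓ` is nonsingular and `c`-dominant in the pivot-row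
block `F(I_ℓ, 𝕊 × J_{ℓ+2})` — exchanging any one of its columns for a column `(a) ⊕ col (ℓ+1) y'`
multiplies `‖det‖` by at most `c` — then `‖(C_ℓ^a)_{t y'}‖ ≤ c`.  For `c = 1` this is the
dominance of a (locally) maximal-volume submatrix, which under column nesting
`J_{ℓ+1} ⊆ 𝕊 × J_{ℓ+2}` is the hypothesis of Savostyanov's Theorem 2 at bond `ℓ`.
[cite: Savostyanov2014, §2 and §4, proof of Thm. 2][cite: AllenLaiShen2024, Lemma 1] -/
theorem norm_coeffMat_le_of_det_exchange_le {ℓ : ℕ} (hP : IsUnit (p.pivMat F ℓ).det) {c : ℝ}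
    (hdom : ∀ (a : σ) (y' : Fin (p.χ (ℓ + 1))) (t : Fin (p.χ ℓ)),
      ‖((unfoldingKernel F).submatrix (p.row ℓ)
          (Function.update (p.col ℓ) t (a :: p.col (ℓ + 1) y'))).det‖ ≤
        c * ‖(p.pivMat F ℓ).det‖)
    (a : σ) (t : Fin (p.χ ℓ)) (y' : Fin (p.χ (ℓ + 1))) : ‖p.coeffMat F ℓ a t y'‖ ≤ c := by
  have hdet : 0 < ‖(p.pivMat F ℓ).det‖ := norm_pos_iff.mpr hP.ne_zero
  have key : ‖p.coeffMat F ℓ a t y'‖ * ‖(p.pivMat F ℓ).det‖ ≤ c * ‖(p.pivMat F ℓ).det‖ := by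
    rw [← norm_mul, p.coeffMat_mul_det F hP a t y']
    exact hdom a y' t
  exact le_of_mul_le_mul_right key hdet

/-- Maximal volume (`c = 1`) ⇒ `‖(C_ℓ^a)_{t y'}‖ ≤ 1`.
[cite: Savostyanov2014, §2 and §4, proof of Thm. 2][cite: AllenLaiShen2024, Lemma 1] -/
theorem norm_coeffMat_le_one_of_volume_maximal {ℓ : ℕ} (hP : IsUnit (p.pivMat F ℓ).det)
    (hmax : ∀ (a : σ) (y' : Fin (p.χ (ℓ + 1))) (t : Fin (p.χ ℓ)),
      ‖((unfoldingKernel F).submatrix (p.row ℓ)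
          (Function.update (p.col ℓ) t (a :: p.col (ℓ + 1) y'))).det‖ ≤ ‖(p.pivMat F ℓ).det‖)
    (a : σ) (t : Fin (p.χ ℓ)) (y' : Fin (p.χ (ℓ + 1))) : ‖p.coeffMat F ℓ a t y'‖ ≤ 1 :=
  p.norm_coeffMat_le_of_det_exchange_le F hP (c := 1) (fun a y' t => by
    rw [one_mul]; exact hmax a y' t) a t y'

/-- From an entrywise coefficient bound to the column-sum (amplification) bound:
`‖(C_ℓ^a)_{t y'}‖ ≤ c` for all `t` gives `Σ_t ‖(C_ℓ^a)_{t y'}‖ ≤ χ_ℓ · c`.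
[cite: Savostyanov2014, §4, proof of Thm. 2] -/
theorem sum_norm_coeffMat_le {ℓ : ℕ} {a : σ} {c : ℝ}
    (h : ∀ (t : Fin (p.χ ℓ)) (y' : Fin (p.χ (ℓ + 1))), ‖p.coeffMat F ℓ a t y'‖ ≤ c)
    (y' : Fin (p.χ (ℓ + 1))) : ∑ t, ‖p.coeffMat F ℓ a t y'‖ ≤ p.χ ℓ * c :=
  calc ∑ t, ‖p.coeffMat F ℓ a t y'‖ ≤ ∑ _t : Fin (p.χ ℓ), c := Finset.sum_le_sum fun t _ => h t y'
    _ = p.χ ℓ * c := by simp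

/-- ONE STEP OF ERROR AMPLIFICATION: if the column sums of the coefficient matrix of bond `k+1`
are `≤ γ` (`Σ_t ‖(C_{k+1}^{s(k+1)})_{t y'}‖ ≤ γ`), the level-`k` errors are `≤ δ` and the local
errors of bond `k+1` are `≤ e`, then the level-`(k+1)` errors are `≤ e + γ δ`.  With maximal-volume
pivots (`‖C‖ ≤ 1`, `γ = χ_{k+1} ≤ r`) this is Savostyanov's `|Δ_{k+1}| ≤ r |Δ_k| + |E_k|`.
[cite: Savostyanov2014, §4, proof of Thm. 2] -/
theorem norm_lvlErr_succ_le (s : ℕ → σ) (k : ℕ) {γ δ e : ℝ} (hδ : 0 ≤ δ)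
    (hC : ∀ y', ∑ t, ‖p.coeffMat F (k + 1) (s (k + 1)) t y'‖ ≤ γ)
    (hΔ : ∀ t, ‖p.lvlErr F s k t‖ ≤ δ)
    (hE : ∀ y', ‖p.bondErr F (k + 1) (pfx s (k + 1)) (s (k + 1)) y'‖ ≤ e)
    (y' : Fin (p.χ (k + 1 + 1))) : ‖p.lvlErr F s (k + 1) y'‖ ≤ e + γ * δ := by
  rw [lvlErr_succ]
  refine (norm_add_le _ _).trans (add_le_add (hE y') ?_)
  calc ‖∑ t, p.lvlErr F s k t * p.coeffMat F (k + 1) (s (k + 1)) t y'‖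
      ≤ ∑ t, ‖p.lvlErr F s k t * p.coeffMat F (k + 1) (s (k + 1)) t y'‖ := norm_sum_le _ _
    _ = ∑ t, ‖p.lvlErr F s k t‖ * ‖p.coeffMat F (k + 1) (s (k + 1)) t y'‖ := by
        simp_rw [norm_mul]
    _ ≤ ∑ t, δ * ‖p.coeffMat F (k + 1) (s (k + 1)) t y'‖ :=
        Finset.sum_le_sum fun t _ => mul_le_mul_of_nonneg_right (hΔ t) (norm_nonneg _)
    _ = δ * ∑ t, ‖p.coeffMat F (k + 1) (s (k + 1)) t y'‖ := (Finset.mul_sum _ _ _).symm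
    _ ≤ δ * γ := mul_le_mul_of_nonneg_left (hC y') hδ
    _ = γ * δ := mul_comm _ _

/-- THE ACCUMULATED ERROR: for a configuration `s`, if for every bond `1 ≤ ℓ ≤ k` the local
cross-interpolation errors at the row `(s 0, …, s (ℓ-1))` are `≤ e_ℓ` and the column sums of the
coefficient matrix `C_ℓ^{s ℓ}` are `≤ γ_ℓ`, then `‖Δ_k(s; y)‖ ≤ B_k` for all `y`.
[cite: Savostyanov2014, §4, proof of Thm. 2] -/
theorem norm_lvlErr_le_errBound (s : ℕ → σ) {e γ : ℕ → ℝ} (he : ∀ ℓ, 0 ≤ e ℓ)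
    (hγ : ∀ ℓ, 0 ≤ γ ℓ) :
    ∀ k, (∀ ℓ, 1 ≤ ℓ → ℓ ≤ k → ∀ y', ‖p.bondErr F ℓ (pfx s ℓ) (s ℓ) y'‖ ≤ e ℓ) →
      (∀ ℓ, 1 ≤ ℓ → ℓ ≤ k → ∀ y', ∑ t, ‖p.coeffMat F ℓ (s ℓ) t y'‖ ≤ γ ℓ) →
      ∀ y, ‖p.lvlErr F s k y‖ ≤ errBound e γ k
  | 0, _, _, y => by simp [lvlErr_zero]
  | k + 1, hE, hC, y => by
      rw [errBound_succ]
      exact p.norm_lvlErr_succ_le F s k (errBound_nonneg he hγ k) (hC (k + 1) (by omega) le_rfl)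
        (norm_lvlErr_le_errBound s he hγ k (fun ℓ h₁ h₂ => hE ℓ h₁ (by omega))
          (fun ℓ h₁ h₂ => hC ℓ h₁ (by omega)))
        (hE (k + 1) (by omega) le_rfl) y

/-- ERROR PROPAGATION THEOREM FOR THE TENSOR CROSS INTERPOLATION: with per-bond local error
bounds `e_ℓ` (Chebyshev error of the one-bond cross interpolations at the rows met by `s`) and
amplification factors `γ_ℓ` (column sums of `‖C_ℓ^{s ℓ}‖`) for the inner bonds `1 ≤ ℓ ≤ n`,
`‖F(s) - F̃(s)‖ ≤ B_n = Σ_ℓ e_ℓ Π_{i > ℓ} γ_i`.  No nesting is needed for this inequality; nesting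
(Lemma 3) is what identifies `Δ_k` with the error on subtensors and makes `P_ℓ` a submatrix of the
block it must dominate.
[cite: Savostyanov2014, §4 Thm. 2 and its proof][cite: DolgovSavostyanov2020, §3.2] -/
theorem norm_sub_tciEval_le_errBound (s : ℕ → σ) {e γ : ℕ → ℝ} (he : ∀ ℓ, 0 ≤ e ℓ)
    (hγ : ∀ ℓ, 0 ≤ γ ℓ)
    (hE : ∀ ℓ, 1 ≤ ℓ → ℓ ≤ p.n → ∀ y', ‖p.bondErr F ℓ (pfx s ℓ) (s ℓ) y'‖ ≤ e ℓ)
    (hC : ∀ ℓ, 1 ≤ ℓ → ℓ ≤ p.n → ∀ y', ∑ t, ‖p.coeffMat F ℓ (s ℓ) t y'‖ ≤ γ ℓ) :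
    ‖F (pfx s (p.n + 1)) - p.tciEval F s‖ ≤ errBound e γ p.n := by
  rw [sub_tciEval_eq_lvlErr]
  exact p.norm_lvlErr_le_errBound F s he hγ p.n hE hC _

/-- Uniform version: local errors `≤ e₀` and amplification factors `≤ g` at every inner bond give
`‖F(s) - F̃(s)‖ ≤ e₀ Σ_{j<n} g^j` for an `(n+1)`-leg tensor (`n` inner bonds... of which the first
contributes no amplification).
[cite: Savostyanov2014, §4 Thm. 2][cite: DolgovSavostyanov2020, §3.2] -/
theorem norm_sub_tciEval_le_mul_geom_sum (s : ℕ → σ) {e₀ g : ℝ} (he₀ : 0 ≤ e₀) (hg : 0 ≤ g)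
    (hE : ∀ ℓ, 1 ≤ ℓ → ℓ ≤ p.n → ∀ y', ‖p.bondErr F ℓ (pfx s ℓ) (s ℓ) y'‖ ≤ e₀)
    (hC : ∀ ℓ, 1 ≤ ℓ → ℓ ≤ p.n → ∀ y', ∑ t, ‖p.coeffMat F ℓ (s ℓ) t y'‖ ≤ g) :
    ‖F (pfx s (p.n + 1)) - p.tciEval F s‖ ≤ e₀ * ∑ j ∈ Finset.range p.n, g ^ j :=
  (p.norm_sub_tciEval_le_errBound F s (e := fun _ => e₀) (γ := fun _ => g) (fun _ => he₀)
    (fun _ => hg) hE hC).trans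
    (errBound_le_mul_geom_sum (fun _ => he₀) (fun _ => hg) p.n (fun _ _ _ => le_rfl)
      (fun _ _ _ => le_rfl))

/-- SAVOSTYANOV'S THEOREM 2 (structure of the bound): if every inner pivot matrix `P_ℓ`
(`1 ≤ ℓ ≤ n`) is nonsingular and dominant in its pivot-row block `F(I_ℓ, 𝕊 × J_{ℓ+2})` (as a
maximal-volume choice is), the bond dimensions are `≤ r`, and the one-bond cross interpolations
have Chebyshev error `≤ e₀` at the rows met by `s`, then
`‖F(s) - F̃(s)‖ ≤ e₀ (1 + r + ⋯ + r^{n-1})` for the `(n+1)`-leg tensor.  With maximal-volume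
pivots `e₀ = (r+1)² E_C`
(`Literature.LinearAlgebra.Matrix.abs_sub_crossInterp_le_of_volume_maximal`)
this is the printed `|A - Ã| ≤ (r^{d-1} - 1)/(r - 1) · (r+1)² E_C`, `d = n+1`.
[cite: Savostyanov2014, §4 Thm. 2][cite: DolgovSavostyanov2020, §3.2] -/
theorem norm_sub_tciEval_le_of_dominant (s : ℕ → σ) {r : ℕ} {e₀ : ℝ} (he₀ : 0 ≤ e₀)
    (hP : ∀ ℓ, 1 ≤ ℓ → ℓ ≤ p.n → IsUnit (p.pivMat F ℓ).det)
    (hdom : ∀ ℓ, 1 ≤ ℓ → ℓ ≤ p.n → ∀ (a : σ) (y' : Fin (p.χ (ℓ + 1))) (t : Fin (p.χ ℓ)),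
      ‖((unfoldingKernel F).submatrix (p.row ℓ)
          (Function.update (p.col ℓ) t (a :: p.col (ℓ + 1) y'))).det‖ ≤ ‖(p.pivMat F ℓ).det‖)
    (hχ : ∀ ℓ, 1 ≤ ℓ → ℓ ≤ p.n → p.χ ℓ ≤ r)
    (hE : ∀ ℓ, 1 ≤ ℓ → ℓ ≤ p.n → ∀ y', ‖p.bondErr F ℓ (pfx s ℓ) (s ℓ) y'‖ ≤ e₀) :
    ‖F (pfx s (p.n + 1)) - p.tciEval F s‖ ≤ e₀ * ∑ j ∈ Finset.range p.n, (r : ℝ) ^ j := by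
  refine p.norm_sub_tciEval_le_mul_geom_sum F s he₀ (Nat.cast_nonneg r) hE fun ℓ h₁ h₂ y' => ?_
  calc ∑ t, ‖p.coeffMat F ℓ (s ℓ) t y'‖ ≤ p.χ ℓ * (1 : ℝ) :=
        p.sum_norm_coeffMat_le F (fun t y'' =>
          p.norm_coeffMat_le_one_of_volume_maximal F (hP ℓ h₁ h₂) (hdom ℓ h₁ h₂) (s ℓ) t y'') y'
    _ ≤ r := by rw [mul_one]; exact_mod_cast hχ ℓ h₁ h₂

/-- Closed form of the previous bound for `r ≠ 1`: `‖F(s) - F̃(s)‖ ≤ e₀ (r^n - 1)/(r - 1)` —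
Savostyanov's coefficient `(r^{d-1} - 1)/(r - 1)` for `d = n+1` legs.
[cite: Savostyanov2014, §4 Thm. 2] -/
theorem norm_sub_tciEval_le_of_dominant' (s : ℕ → σ) {r : ℕ} (hr : r ≠ 1) {e₀ : ℝ}
    (he₀ : 0 ≤ e₀) (hP : ∀ ℓ, 1 ≤ ℓ → ℓ ≤ p.n → IsUnit (p.pivMat F ℓ).det)
    (hdom : ∀ ℓ, 1 ≤ ℓ → ℓ ≤ p.n → ∀ (a : σ) (y' : Fin (p.χ (ℓ + 1))) (t : Fin (p.χ ℓ)),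
      ‖((unfoldingKernel F).submatrix (p.row ℓ)
          (Function.update (p.col ℓ) t (a :: p.col (ℓ + 1) y'))).det‖ ≤ ‖(p.pivMat F ℓ).det‖)
    (hχ : ∀ ℓ, 1 ≤ ℓ → ℓ ≤ p.n → p.χ ℓ ≤ r)
    (hE : ∀ ℓ, 1 ≤ ℓ → ℓ ≤ p.n → ∀ y', ‖p.bondErr F ℓ (pfx s ℓ) (s ℓ) y'‖ ≤ e₀) :
    ‖F (pfx s (p.n + 1)) - p.tciEval F s‖ ≤ e₀ * (((r : ℝ) ^ p.n - 1) / (r - 1)) := by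
  have hr' : (r : ℝ) ≠ 1 := by exact_mod_cast hr
  rw [← geom_sum_eq hr' p.n]
  exact p.norm_sub_tciEval_le_of_dominant F s he₀ hP hdom hχ hE

end Normed

/-! ### Savostyanov's Theorem 2 (Chebyshev norm, finitely many leg values) -/

section MaxVol

variable (F : List σ → ℝ)

/-- [folklore] -/
private theorem length_pfx' (s : ℕ → σ) : ∀ k, (pfx s k).length = k
  | 0 => rfl
  | k + 1 => by simp [pfx_succ', length_pfx' s k]

/-- SAVOSTYANOV'S THEOREM 2 (Chebyshev-norm version) for real tensors with finitely many leg
values, legs `0, …, n` (`d = n+1`): suppose the column pivots are RIGHT-NESTED with witnesses `c`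
(`col ℓ t = (c ℓ t).1 ⊕ col (ℓ+1) (c ℓ t).2`, i.e. `J_{ℓ+1} ⊆ 𝕊_ℓ × J_{ℓ+2}`, inner bonds
`1 ≤ ℓ ≤ n`), every pivot matrix `P_ℓ` is nonsingular and has MAXIMAL VOLUME in the sub-unfolding
`[A(i_{<ℓ} ; 𝕊_ℓ × J_{ℓ+2})]` (among all its `χ_ℓ × χ_ℓ` submatrices), every such sub-unfolding is
entrywise within `δ` of a matrix of rank `≤ χ_ℓ` (which holds with `δ = E_C` when the whole tensor
is within `E_C` of a tensor train of ranks `(χ_ℓ)`, the standing assumption of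
[Savostyanov2014, §3]), and `χ_ℓ ≤ r`.  Then at
every configuration `s`,
`|A(s) - Ã(s)| ≤ (r+1)² δ (1 + r + ⋯ + r^{n-1}) = (r^{d-1} - 1)/(r - 1) · (r+1)² δ`.
The one-bond errors are bounded by the matrix maximal-volume principle
(`Literature.LinearAlgebra.Matrix.abs_sub_crossInterp_le_of_volume_maximal`, `(χ_ℓ+1)² δ`) and
propagated by `norm_sub_tciEval_le_of_dominant`.
[cite: Savostyanov2014, §4 Thm. 2][cite: DolgovSavostyanov2020, §3.2] -/
theorem abs_sub_tciEval_le_of_volume_maximal [Fintype σ] (s : ℕ → σ) {r : ℕ} {δ : ℝ}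
    (hδ : 0 ≤ δ) (c : (ℓ : ℕ) → Fin (p.χ ℓ) → σ × Fin (p.χ (ℓ + 1)))
    (hc : ∀ ℓ, 1 ≤ ℓ → ℓ ≤ p.n → ∀ t, p.col ℓ t = (c ℓ t).1 :: p.col (ℓ + 1) (c ℓ t).2)
    (hP : ∀ ℓ, 1 ≤ ℓ → ℓ ≤ p.n → IsUnit (p.pivMat F ℓ).det)
    (hmax : ∀ ℓ, 1 ≤ ℓ → ℓ ≤ p.n →
      ∀ (r' : Fin (p.χ ℓ) → List.Vector σ ℓ) (c' : Fin (p.χ ℓ) → σ × Fin (p.χ (ℓ + 1))),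
        |((p.subUnfolding F ℓ).submatrix r' c').det| ≤ |(p.pivMat F ℓ).det|)
    (hlow : ∀ ℓ, 1 ≤ ℓ → ℓ ≤ p.n →
      ∃ X : Matrix (List.Vector σ ℓ) (σ × Fin (p.χ (ℓ + 1))) ℝ,
        X.rank ≤ p.χ ℓ ∧ ∀ i j, |p.subUnfolding F ℓ i j - X i j| ≤ δ)
    (hχ : ∀ ℓ, 1 ≤ ℓ → ℓ ≤ p.n → p.χ ℓ ≤ r) :
    |F (pfx s (p.n + 1)) - p.tciEval F s| ≤
      ((r : ℝ) + 1) ^ 2 * δ * ∑ j ∈ Finset.range p.n, (r : ℝ) ^ j := by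
  have he₀ : 0 ≤ ((r : ℝ) + 1) ^ 2 * δ := mul_nonneg (sq_nonneg _) hδ
  rw [← Real.norm_eq_abs]
  refine p.norm_sub_tciEval_le_of_dominant F s he₀ hP (fun ℓ h₁ h₂ a y' t => ?_) hχ
    (fun ℓ h₁ h₂ y' => ?_)
  · rw [p.submatrix_unfoldingKernel_update_eq F (hc ℓ h₁ h₂) t a y', Real.norm_eq_abs,
      Real.norm_eq_abs]
    exact hmax ℓ h₁ h₂ _ _
  · obtain ⟨X, hXr, hXδ⟩ := hlow ℓ h₁ h₂
    have hPs : IsUnit ((p.subUnfolding F ℓ).submatrix (p.rowVec ℓ) (c ℓ)).det := by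
      rw [p.subUnfolding_submatrix_eq_pivMat F (hc ℓ h₁ h₂)]; exact hP ℓ h₁ h₂
    have hmax' : ∀ (r' : Fin (p.χ ℓ) → List.Vector σ ℓ)
        (c' : Fin (p.χ ℓ) → σ × Fin (p.χ (ℓ + 1))),
        |((p.subUnfolding F ℓ).submatrix r' c').det| ≤
          |((p.subUnfolding F ℓ).submatrix (p.rowVec ℓ) (c ℓ)).det| := fun r' c' => by
      rw [p.subUnfolding_submatrix_eq_pivMat F (hc ℓ h₁ h₂)]; exact hmax ℓ h₁ h₂ r' c'
    have hXr' : X.rank ≤ Fintype.card (Fin (p.χ ℓ)) := by rwa [Fintype.card_fin]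
    have key := Literature.LinearAlgebra.Matrix.abs_sub_crossInterp_le_of_volume_maximal
      (p.subUnfolding F ℓ) (p.rowVec ℓ) (c ℓ) hPs hmax' X hXr' hXδ ⟨pfx s ℓ, length_pfx' s ℓ⟩
      (s ℓ, y')
    rw [Fintype.card_fin, ← p.bondErr_eq_sub_crossInterp_subUnfolding F (hc ℓ h₁ h₂)] at key
    rw [Real.norm_eq_abs]
    refine key.trans ?_
    have hχr : (p.χ ℓ : ℝ) ≤ r := by exact_mod_cast hχ ℓ h₁ h₂
    have h1 : ((p.χ ℓ : ℝ) + 1) ^ 2 ≤ ((r : ℝ) + 1) ^ 2 := by gcongr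
    exact mul_le_mul_of_nonneg_right h1 hδ

/-- Closed form of Savostyanov's Theorem 2 for `r ≠ 1`:
`|A(s) - Ã(s)| ≤ (r+1)² δ (r^n - 1)/(r - 1)`, the printed `(r^{d-1} - 1)/(r - 1) · (r+1)² E_C`
for `d = n+1` legs.  [cite: Savostyanov2014, §4 Thm. 2] -/
theorem abs_sub_tciEval_le_of_volume_maximal' [Fintype σ] (s : ℕ → σ) {r : ℕ} (hr : r ≠ 1)
    {δ : ℝ} (hδ : 0 ≤ δ) (c : (ℓ : ℕ) → Fin (p.χ ℓ) → σ × Fin (p.χ (ℓ + 1)))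
    (hc : ∀ ℓ, 1 ≤ ℓ → ℓ ≤ p.n → ∀ t, p.col ℓ t = (c ℓ t).1 :: p.col (ℓ + 1) (c ℓ t).2)
    (hP : ∀ ℓ, 1 ≤ ℓ → ℓ ≤ p.n → IsUnit (p.pivMat F ℓ).det)
    (hmax : ∀ ℓ, 1 ≤ ℓ → ℓ ≤ p.n →
      ∀ (r' : Fin (p.χ ℓ) → List.Vector σ ℓ) (c' : Fin (p.χ ℓ) → σ × Fin (p.χ (ℓ + 1))),
        |((p.subUnfolding F ℓ).submatrix r' c').det| ≤ |(p.pivMat F ℓ).det|)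
    (hlow : ∀ ℓ, 1 ≤ ℓ → ℓ ≤ p.n →
      ∃ X : Matrix (List.Vector σ ℓ) (σ × Fin (p.χ (ℓ + 1))) ℝ,
        X.rank ≤ p.χ ℓ ∧ ∀ i j, |p.subUnfolding F ℓ i j - X i j| ≤ δ)
    (hχ : ∀ ℓ, 1 ≤ ℓ → ℓ ≤ p.n → p.χ ℓ ≤ r) :
    |F (pfx s (p.n + 1)) - p.tciEval F s| ≤
      ((r : ℝ) + 1) ^ 2 * δ * (((r : ℝ) ^ p.n - 1) / (r - 1)) := by
  have hr' : (r : ℝ) ≠ 1 := by exact_mod_cast hr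
  rw [← geom_sum_eq hr' p.n]
  exact p.abs_sub_tciEval_le_of_volume_maximal F s hδ c hc hP hmax hlow hχ

end MaxVol

end TCIPivots

end Literature.LinearAlgebra.TensorNetworks
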